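import Literature.MathematicalPhysics.KineticTheory.ShortFlightCount
import Literature.MathematicalPhysics.KineticTheory.CollisionFluxMeanBound
import Literature.MathematicalPhysics.KineticTheory.TaggedSphereWindowCount
import HarnessLib

/-!
# Repeated collisions of a tagged hard sphere in a short window: the mean excess count

Topic `Literature/MathematicalPhysics/KineticTheory` — companion of `TaggedSphereWindowCount.lean` (the FIRST
moment of the number `D_i` of collision times of sphere `i` in a window is a one-window static quantity) and of
`ShortFlightCharging.lean` / `ShortFlightCount.lean` (collisions preceded by another collision of a partner are
charged to three-body contact configurations).  Wanted by the crux line `Sketch` of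
`InformationPercolationEngine.CollisionRate` (stmt-AtomisticToContinuum-13481): the EXCESS count
`Σ_i (D_i − 1)₊` — the collisions of each sphere beyond its first one in the window `[0, T]` — of `N + 1` hard
spheres of diameter `ε = hsDiameter σ N` on `𝕋³`.

* `sum_ncard_collisionTimesOf_sub_one_le_chargedSums` — PATHWISE CHARGING along a good orbit: a non-first
  collision `(s, i, j)` of sphere `i` in `[0, T]` is preceded by a collision of `i` at a time in `[0, s)`, so the
  later `s''` of the last collisions of `i` and of `j` before `s` is a collision time in `[0, s)` after which both
  fly freely up to their contact at `s` (`flightStart`, based before time `0` so that a collision AT time `0`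
  is an honest flight start).  Either the collision at `s''` is between `i` and `j` themselves — two contacts of
  one pair in free flight on the torus within time `< 2T` force the pair to wrap around the torus, relative speed
  `≥ (1/2 − ε)/(2T)` (`one_le_relSpeed_div_of_recollision`) — or the partner that collided at `s''` did so with a
  third sphere, and at the post-collisional configuration of `s''` the other partner is on a free collision
  course with it, contact within time `2T` (`charge_spec`); at most two ordered collisions are charged to one
  `(s'', p, m)`.  Hence `Σ_i (D_i − 1)₊ ≤ K₃ + 2 K_F` with the velocity-mark sum
  `K₃ = Σ_coll ‖v_j − v_i‖ / ((1/2 − ε)/(2T))` and the collision sum `K_F` of the FORWARD-CONTACT COUNT of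
  `ShortFlightCharging` (window `2T`) — no early-collision term.
* `lintegral_windowEvent_velWeight_le` — the static one-window bound for the explicit lift-in-swept-tube event
  with a velocity weight (the event of `ShortFlightCount`, the bound of `exists_windowEvent_of_pairBound`).
* `sum_lintegral_ncard_collisionTimesOf_sub_one_le` — under the homogeneous (rung-0) Gibbs law `G_N`, ASSUMED
  invariant under the flow (`hstat`), with the canonical pair / three-label bounds (`hpair`, `htriple`), swept tubes
  (`htube`) and the minimal-image lift inequality (`hlift`) as hypotheses (supplied problem-side, as in
  `CollisionFluxUpperBound`): `Σ_i ∫ (D_i − 1)₊ dG_N ≤ (128 T² (N+1)² ε² + 1024 T² (N+1)³ ε⁴) · E‖w − v‖²`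
  for `ε ≤ 1/4`, by the mean window bound `lintegral_le_liminf_of_le_collisionSum` fed with ONE mark
  `b + 2F` (pull-back of the forward-contact count along the backward flights of the window into two-sided tubes,
  `exists_latticeVec_mem_twoSidedTube`; statics `measure_windowEvent_inter_tubeEvent_le`); the mesh cancels.
* `sum_lintegral_windowCollisions_sub_one_le` — in the window vocabulary of `CollisionWindowCompensator`
  (`w = windowLen N τ a ≤ a (N+1)^{-1/3}`, `(N+1) ε² w ≤ σ² a`):
  `Σ_i ∫ (D_{i,0} − 1)₊ dG_N ≤ 192 σ² a² (N+1) · E‖w − v‖²` (`σ ≤ 1/4`), uniformly in `N` — the mean number of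
  spheres that collide TWICE OR MORE in one window is `O(σ² a² (N+1))` against `O(σ² a (N+1))` colliding at all
  (Boltzmann's "no two collisions of a molecule in `dt`", CIP 1994 App. 4.A, as a quantitative statement at fixed
  reduced density).

Deliberately NOT here: the second factorial moment `E[D_i(D_i − 1)]` (pairs of collisions of one sphere in one
window).  The charging is injective on collisions but NOT on pairs of collisions: a sphere taking part in `D`
collisions of a cluster with `K` collisions would need `D² ≲ K ×` (static mark), i.e. a bound on the number of
collisions per cluster, and hard-ball clusters admit exponentially many collisions (Burago–Ivanov); the second
moment is a measure estimate on such configurations, not a pathwise one.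

## References

* C. Cercignani, R. Illner, M. Pulvirenti, *The Mathematical Theory of Dilute Gases* (1994), §2.2, App. 4.A.
  [CIPDiluteGases1994]
* I. Gallagher, L. Saint-Raymond, B. Texier, *From Newton to Boltzmann* (2013), §4.1, Prop. 4.1.1.  [GST2013]
* D. Ruelle, *Statistical Mechanics: Rigorous Results* (1969), §4.2.  [Ruelle1969]
-/

noncomputable section

open MeasureTheory Set Filter Topology
open scoped ENNReal InnerProductSpace BigOperators Classical

namespace Literature.MathematicalPhysics.KineticTheory

open Literature.Analysis.FluidPDE Literature.Analysis.FunctionSpaces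

/-! ## Pathwise: non-first collisions of a sphere are charged -/

/-- **Pathwise charging of the excess count.**  Along a good orbit on `𝕋³` (`ε < 1/2`), for `T > 0`, the total over
the spheres `i` of the number of collision times of `i` in `[0, T]` BEYOND THE FIRST (truncated subtraction: `0` for a
sphere without collision) is at most `K₃ + 2 K_F`: `K₃ = Σ_{collisions (s,i,j), s ∈ [0,T]} ‖v_j − v_i‖ / ((1/2 − ε)/(2T))`
and `K_F` the collision sum over `[0, T]` of the forward-contact count
`#{j' ∉ {i, j} : ‖reprSym((x_{j'} − x_i) + proj(t (v_{j'} − v_i)))‖ = ε for some t ∈ (0, 2T)}` read at the collision.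
(A non-first collision `(s, i, j)` of `i` has the flight start of `i` in `[0, s)`; the later flight start `s''` of `i`, `j`
is a collision in `[0, s)` followed by free flight of both up to `s`, `s − s'' < 2T`; a re-collision of the same pair costs
relative speed `≥ (1/2 − ε)/(2T)` (`one_le_relSpeed_div_of_recollision`), any other is charged to `(s'', p, m)` by
`charge_spec`, at most two per target.) [folklore] -/
theorem sum_ncard_collisionTimesOf_sub_one_le_chargedSums {σ : ℝ} {N : ℕ}
    {Φ : HardSphereFlow (Torus.geometry (Fin 3)) (hsDiameter σ N) (N + 1)} {z : Config (N + 1) (Fin 3) T3}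
    (hz : z ∈ Φ.good) (hε2 : hsDiameter σ N < 1 / 2) {T : ℝ} (hT : 0 < T) :
    (∑ i : Fin (N + 1), (((collisionTimesOf (Torus.geometry (Fin 3)) (hsDiameter σ N) (orbit σ N Φ z) i ∩
        Icc 0 T).ncard - 1 : ℕ) : ℝ)) ≤
      collisionPairSum (Torus.geometry (Fin 3)) (hsDiameter σ N) (orbit σ N Φ z) (Icc 0 T)
          (fun s i j => ‖(orbit σ N Φ z s j).2 - (orbit σ N Φ z s i).2‖ / ((1 / 2 - hsDiameter σ N) / (2 * T))) +
        2 * collisionPairSum (Torus.geometry (Fin 3)) (hsDiameter σ N) (orbit σ N Φ z) (Icc 0 T)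
          (fun s i j => ∑ j' : Fin (N + 1), if j' ≠ i ∧ j' ≠ j ∧ ∃ t ∈ Ioo 0 (2 * T),
            ‖Torus.reprSym (((orbit σ N Φ z s j').1 - (orbit σ N Φ z s i).1) +
              Torus.proj (t • ((orbit σ N Φ z s j').2 - (orbit σ N Φ z s i).2)))‖ = hsDiameter σ N
            then (1 : ℝ) else 0) := by
  classical
  have hγ := isTraj hz
  have hG : (Torus.geometry (Fin 3)).IsHardSphereRegular (hsDiameter σ N) :=
    Torus.isHardSphereRegular_geometry (by rw [← one_div]; exact hε2)
  have hfinT := hγ.locFinite 0 T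
  have hTf := finite_collisionTriples hfinT
  rw [collisionPairSum_eq_finsum_triples hfinT, collisionPairSum_eq_finsum_triples hfinT,
    finsum_mem_eq_finite_toFinset_sum _ hTf, finsum_mem_eq_finite_toFinset_sum _ hTf]
  -- notation
  set Tr := hTf.toFinset with hTrdef
  set fs : Fin (N + 1) → ℝ → ℝ := fun k s =>
    flightStart (Torus.geometry (Fin 3)) (hsDiameter σ N) (orbit σ N Φ z) (-T) k s with hfsdef
  set st : ℝ × Fin (N + 1) × Fin (N + 1) → ℝ := fun e => max (fs e.2.1 e.1) (fs e.2.2 e.1) with hstdef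
  set ld : ℝ × Fin (N + 1) × Fin (N + 1) → Fin (N + 1) := fun e =>
    if fs e.2.2 e.1 ≤ fs e.2.1 e.1 then e.2.1 else e.2.2 with hlddef
  set ot : ℝ × Fin (N + 1) × Fin (N + 1) → Fin (N + 1) := fun e =>
    if fs e.2.2 e.1 ≤ fs e.2.1 e.1 then e.2.2 else e.2.1 with hotdef
  set F : ℝ × Fin (N + 1) × Fin (N + 1) → ℝ := fun e => ∑ j' : Fin (N + 1),
    if j' ≠ e.2.1 ∧ j' ≠ e.2.2 ∧ ∃ t ∈ Ioo 0 (2 * T),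
      ‖Torus.reprSym (((orbit σ N Φ z e.1 j').1 - (orbit σ N Φ z e.1 e.2.1).1) +
        Torus.proj (t • ((orbit σ N Φ z e.1 j').2 - (orbit σ N Φ z e.1 e.2.1).2)))‖ = hsDiameter σ N
      then (1 : ℝ) else 0 with hFdef
  set b : ℝ × Fin (N + 1) × Fin (N + 1) → ℝ := fun e =>
    ‖(orbit σ N Φ z e.1 e.2.2).2 - (orbit σ N Φ z e.1 e.2.1).2‖ / ((1 / 2 - hsDiameter σ N) / (2 * T)) with hbdef
  set Θ : ℝ × Fin (N + 1) × Fin (N + 1) → ℝ × Fin (N + 1) × Fin (N + 1) := fun e =>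
    (st e, ld e, partner (Torus.geometry (Fin 3)) (hsDiameter σ N) (orbit σ N Φ z (st e)) (ld e)) with hΘdef
  -- the charged collisions: those whose first partner has a flight start in `[0, s)`
  set A : Finset (ℝ × Fin (N + 1) × Fin (N + 1)) := Tr.filter fun e => 0 ≤ fs e.2.1 e.1 with hAdef
  set A₁ : Finset (ℝ × Fin (N + 1) × Fin (N + 1)) := A.filter fun e =>
    ¬ Participates (Torus.geometry (Fin 3)) (hsDiameter σ N) (orbit σ N Φ z (st e)) (ot e) with hA₁def
  set A₂ : Finset (ℝ × Fin (N + 1) × Fin (N + 1)) := A.filter fun e =>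
    Participates (Torus.geometry (Fin 3)) (hsDiameter σ N) (orbit σ N Φ z (st e)) (ot e) with hA₂def
  change (∑ i : Fin (N + 1), (((collisionTimesOf (Torus.geometry (Fin 3)) (hsDiameter σ N) (orbit σ N Φ z) i ∩
      Icc 0 T).ncard - 1 : ℕ) : ℝ)) ≤ ∑ e ∈ Tr, b e + 2 * ∑ e ∈ Tr, F e
  -- membership in the triples
  have hTr : ∀ e ∈ Tr, e.1 ∈ Icc 0 T ∧
      e.2 ∈ contactPairs (Torus.geometry (Fin 3)) (hsDiameter σ N) (orbit σ N Φ z e.1) := fun e he =>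
    mem_collisionTriples.1 (hTf.mem_toFinset.1 he)
  have hfink : ∀ (k : Fin (N + 1)) (t : ℝ), (collisionTimesOf (Torus.geometry (Fin 3)) (hsDiameter σ N)
      (orbit σ N Φ z) k ∩ Ioo (-T) t).Finite := fun k t => hγ.finite_collisionTimesOf_inter_Ioo k (-T) t
  -- (1) the excess count is at most the number of charged collisions
  have h1 : (∑ i : Fin (N + 1), (((collisionTimesOf (Torus.geometry (Fin 3)) (hsDiameter σ N) (orbit σ N Φ z) i ∩
      Icc 0 T).ncard - 1 : ℕ) : ℝ)) ≤ (A.card : ℝ) := by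
    have hfib : ∀ i : Fin (N + 1), ((collisionTimesOf (Torus.geometry (Fin 3)) (hsDiameter σ N) (orbit σ N Φ z) i ∩
        Icc 0 T).ncard - 1 : ℕ) ≤ (A.filter fun e => e.2.1 = i).card := by
      intro i
      have hSfin : (collisionTimesOf (Torus.geometry (Fin 3)) (hsDiameter σ N) (orbit σ N Φ z) i ∩ Icc 0 T).Finite :=
        hfinT.subset (inter_subset_inter_left _ (collisionTimesOf_subset _ i))
      set Si := hSfin.toFinset with hSidef
      rw [Set.ncard_eq_toFinset_card _ hSfin]
      by_cases hne : Si.Nonempty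
      · set s₀ := Si.min' hne with hs₀def
        have hs₀ : s₀ ∈ Si := Si.min'_mem hne
        obtain ⟨hs₀c, hs₀I⟩ := (Set.Finite.mem_toFinset hSfin).1 hs₀
        rw [← Finset.card_erase_of_mem hs₀]
        refine Finset.card_le_card_of_injOn (fun s => (s, i, partner (Torus.geometry (Fin 3)) (hsDiameter σ N)
          (orbit σ N Φ z s) i)) (fun s hs => ?_) (fun s _ s' _ h => congrArg Prod.fst h)
        obtain ⟨hss₀, hsS⟩ := Finset.mem_erase.1 hs
        obtain ⟨hsc, hsI⟩ := (Set.Finite.mem_toFinset hSfin).1 hsS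
        have hlt : s₀ < s := lt_of_le_of_ne (Si.min'_le s hsS) (Ne.symm hss₀)
        have hpart : Participates (Torus.geometry (Fin 3)) (hsDiameter σ N) (orbit σ N Φ z s) i := hsc
        have hcp : (i, partner (Torus.geometry (Fin 3)) (hsDiameter σ N) (orbit σ N Φ z s) i) ∈
            contactPairs (Torus.geometry (Fin 3)) (hsDiameter σ N) (orbit σ N Φ z s) := by
          rcases collide_partner hpart with h | h
          · exact h
          · exact (swap_mem_contactPairs_iff hG).1 h
        have hmemTr : (s, i, partner (Torus.geometry (Fin 3)) (hsDiameter σ N) (orbit σ N Φ z s) i) ∈ Tr :=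
          hTf.mem_toFinset.2 ⟨hsI, hcp⟩
        have hfs : 0 ≤ fs i s :=
          hs₀I.1.trans (le_flightStart_of_mem (hfink i s) hs₀c (by linarith [hs₀I.1]) hlt)
        rw [Finset.mem_coe, Finset.mem_filter]
        exact ⟨Finset.mem_filter.2 ⟨hmemTr, hfs⟩, rfl⟩
      · have hemp : hSfin.toFinset = ∅ := Finset.not_nonempty_iff_eq_empty.1 hne
        rw [hemp, Finset.card_empty]
        exact Nat.zero_le _
    have hsum : A.card = ∑ i : Fin (N + 1), (A.filter fun e => e.2.1 = i).card :=
      Finset.card_eq_sum_card_fiberwise fun e _ => Finset.mem_univ e.2.1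
    rw [hsum]
    push_cast
    exact Finset.sum_le_sum fun i _ => by exact_mod_cast hfib i
  -- the lead particle realises the later flight start
  have hld : ∀ e, st e = fs (ld e) e.1 ∧ fs (ot e) e.1 ≤ st e ∧
      ((ld e = e.2.1 ∧ ot e = e.2.2) ∨ (ld e = e.2.2 ∧ ot e = e.2.1)) := by
    intro e
    by_cases h : fs e.2.2 e.1 ≤ fs e.2.1 e.1
    · have hl : ld e = e.2.1 := by rw [hlddef]; exact if_pos h
      have ho : ot e = e.2.2 := by rw [hotdef]; exact if_pos h
      refine ⟨?_, ?_, Or.inl ⟨hl, ho⟩⟩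
      · rw [hl]; exact max_eq_left h
      · rw [ho]; exact le_max_right _ _
    · have hl : ld e = e.2.2 := by rw [hlddef]; exact if_neg h
      have ho : ot e = e.2.1 := by rw [hotdef]; exact if_neg h
      refine ⟨?_, ?_, Or.inr ⟨hl, ho⟩⟩
      · rw [hl]; exact max_eq_right (not_le.1 h).le
      · rw [ho]; exact le_max_left _ _
  -- consequences of being charged: a collision of the lead particle in `[0, s)`, then free flights up to `s`
  have hβ : ∀ e ∈ A, st e ∈ Ico 0 e.1 ∧ e.1 ≤ T ∧
      Participates (Torus.geometry (Fin 3)) (hsDiameter σ N) (orbit σ N Φ z (st e)) (ld e) ∧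
      (∀ u ∈ Ioo (st e) e.1, ¬ Participates (Torus.geometry (Fin 3)) (hsDiameter σ N) (orbit σ N Φ z u) (ld e)) ∧
      (∀ u ∈ Ioo (st e) e.1, ¬ Participates (Torus.geometry (Fin 3)) (hsDiameter σ N) (orbit σ N Φ z u) (ot e)) ∧
      (ld e, ot e) ∈ contactPairs (Torus.geometry (Fin 3)) (hsDiameter σ N) (orbit σ N Φ z e.1) := by
    intro e he
    obtain ⟨heTr, hfs0⟩ := Finset.mem_filter.1 he
    obtain ⟨heI, hecp⟩ := hTr e heTr
    obtain ⟨hst, hot, hor⟩ := hld e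
    have hst0 : 0 ≤ st e := hfs0.trans (le_max_left _ _)
    have hTe : -T < e.1 := by linarith [heI.1]
    have hstlt : st e < e.1 := by
      rw [hst]; exact flightStart_lt (hfink (ld e) e.1) hTe
    have hmem : st e ∈ collisionTimesOf (Torus.geometry (Fin 3)) (hsDiameter σ N) (orbit σ N Φ z) (ld e) ∩
        Ioo (-T) e.1 := by
      have h : st e ∈ insert (-T) (collisionTimesOf (Torus.geometry (Fin 3)) (hsDiameter σ N) (orbit σ N Φ z) (ld e) ∩
          Ioo (-T) e.1) := by
        rw [hst]; exact flightStart_mem (hfink (ld e) e.1)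
      rcases mem_insert_iff.1 h with h | h
      · exfalso; linarith
      · exact h
    refine ⟨⟨hst0, hstlt⟩, heI.2, hmem.1, fun u hu => ?_, fun u hu => ?_, ?_⟩
    · have hu' : u ∈ Ioo (fs (ld e) e.1) e.1 := by rw [← hst]; exact hu
      exact not_participates_of_mem_Ioo_flightStart (hfink (ld e) e.1) hu'
    · exact not_participates_of_mem_Ioo_flightStart (hfink (ot e) e.1) ⟨hot.trans_lt hu.1, hu.2⟩
    · rcases hor with ⟨h1, h2⟩ | ⟨h1, h2⟩
      · rw [h1, h2]; exact hecp
      · rw [h1, h2]; exact (swap_mem_contactPairs_iff hG).1 hecp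
  -- (2) the charged collisions split according to the participation of the other partner at `st`
  have h2 : (A.card : ℝ) = (A₂.card : ℝ) + (A₁.card : ℝ) := by
    rw [hA₂def, hA₁def]
    exact_mod_cast (Finset.card_filter_add_card_filter_not _).symm
  -- (3) fast re-collisions of the same pair
  have h3 : (A₂.card : ℝ) ≤ ∑ e ∈ Tr, b e := by
    have hA₂T : A₂ ⊆ Tr := fun e he => (Finset.mem_filter.1 (Finset.mem_filter.1 he).1).1
    have hb0 : ∀ e, 0 ≤ b e := fun e => div_nonneg (norm_nonneg _) (div_nonneg (by linarith) (by positivity))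
    calc (A₂.card : ℝ) = ∑ _e ∈ A₂, (1 : ℝ) := by rw [Finset.sum_const, nsmul_eq_mul, mul_one]
      _ ≤ ∑ e ∈ A₂, b e := by
          refine Finset.sum_le_sum fun e he => ?_
          obtain ⟨heA, hpart⟩ := Finset.mem_filter.1 he
          obtain ⟨hIco, heT, hpl, hfl, hfo, hc⟩ := hβ e heA
          have h := one_le_relSpeed_div_of_recollision (ℓ := 2 * T) hz hε2 hIco.2 (by linarith [hIco.1])
            (by positivity) hpl hpart hfl hfo hc
          rcases (hld e).2.2 with ⟨hl, ho⟩ | ⟨hl, ho⟩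
          · rw [hl, ho] at h
            exact h
          · rw [hl, ho, norm_sub_rev] at h
            exact h
      _ ≤ ∑ e ∈ Tr, b e := Finset.sum_le_sum_of_subset_of_nonneg hA₂T fun e _ _ => hb0 e
  -- (4) the charging map on `A₁`
  have hch : ∀ e ∈ A₁, Θ e ∈ Tr ∧ 1 ≤ F (Θ e) ∧
      (∀ u ∈ Ioo (st e) e.1, ¬ Participates (Torus.geometry (Fin 3)) (hsDiameter σ N) (orbit σ N Φ z u) (ld e)) ∧
      Participates (Torus.geometry (Fin 3)) (hsDiameter σ N) (orbit σ N Φ z e.1) (ld e) ∧ st e < e.1 ∧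
      (ld e, ot e) ∈ contactPairs (Torus.geometry (Fin 3)) (hsDiameter σ N) (orbit σ N Φ z e.1) := by
    intro e he
    obtain ⟨heA, hpart⟩ := Finset.mem_filter.1 he
    obtain ⟨hIco, heT, hpl, hfl, hfo, hc⟩ := hβ e heA
    obtain ⟨hpm, hop, hom, t, ht, hhit⟩ :=
      charge_spec (ℓ := 2 * T) hz hε2 hIco.2 (by linarith [hIco.1]) hpl hfl hfo hpart hc
    refine ⟨hTf.mem_toFinset.2 ⟨⟨hIco.1, hIco.2.le.trans heT⟩, hpm⟩, ?_, hfl, ⟨ot e, Or.inl hc⟩, hIco.2, hc⟩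
    have hterm : (1 : ℝ) ≤ (if ot e ≠ ld e ∧
        ot e ≠ partner (Torus.geometry (Fin 3)) (hsDiameter σ N) (orbit σ N Φ z (st e)) (ld e) ∧
        ∃ t ∈ Ioo 0 (2 * T), ‖Torus.reprSym (((orbit σ N Φ z (st e) (ot e)).1 - (orbit σ N Φ z (st e) (ld e)).1) +
          Torus.proj (t • ((orbit σ N Φ z (st e) (ot e)).2 - (orbit σ N Φ z (st e) (ld e)).2)))‖ =
            hsDiameter σ N then (1 : ℝ) else 0) := by
      rw [if_pos ⟨hop, hom, t, ht, hhit⟩]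
    refine hterm.trans ?_
    exact Finset.single_le_sum (f := fun j' => if j' ≠ ld e ∧
        j' ≠ partner (Torus.geometry (Fin 3)) (hsDiameter σ N) (orbit σ N Φ z (st e)) (ld e) ∧
        ∃ t ∈ Ioo 0 (2 * T), ‖Torus.reprSym (((orbit σ N Φ z (st e) j').1 - (orbit σ N Φ z (st e) (ld e)).1) +
          Torus.proj (t • ((orbit σ N Φ z (st e) j').2 - (orbit σ N Φ z (st e) (ld e)).2)))‖ =
            hsDiameter σ N then (1 : ℝ) else 0)
      (fun j' _ => by positivity) (Finset.mem_univ (ot e))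
  -- at most two charged collisions have the same target
  have hfib : ∀ y ∈ A₁.image Θ, (A₁.filter fun e => Θ e = y).card ≤ 2 := by
    intro y hy
    obtain ⟨e₀, he₀, rfl⟩ := Finset.mem_image.1 hy
    obtain ⟨-, -, hf₀, hp₀, hlt₀, hc₀⟩ := hch e₀ he₀
    have hsub : (A₁.filter fun e => Θ e = Θ e₀) ⊆ {(e₀.1, (ld e₀, ot e₀)), (e₀.1, (ot e₀, ld e₀))} := by
      intro e he
      obtain ⟨heB, heq⟩ := Finset.mem_filter.1 he
      obtain ⟨-, -, hf, hp, hlt, hc⟩ := hch e heB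
      have hst : st e = st e₀ := congrArg Prod.fst heq
      have hlde : ld e = ld e₀ := congrArg (fun q => q.2.1) heq
      rw [hst, hlde] at hf
      rw [hlde] at hp hc
      have hs : e.1 = e₀.1 := eq_of_nextCollision (hst ▸ hlt) hlt₀ hf hp hf₀ hp₀
      rw [hs] at hc
      have hpair := hγ.contactPairs_eq_pair hG hc₀
      have h2 : e.2 ∈ contactPairs (Torus.geometry (Fin 3)) (hsDiameter σ N) (orbit σ N Φ z e₀.1) := by
        rcases (hld e).2.2 with ⟨hl, ho⟩ | ⟨hl, ho⟩
        · have : e.2 = (ld e, ot e) := Prod.ext hl.symm ho.symm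
          rw [this, hlde]; exact hc
        · have : e.2 = (ot e, ld e) := Prod.ext ho.symm hl.symm
          rw [this, hlde]; exact (swap_mem_contactPairs_iff hG).2 hc
      rw [hpair, Finset.mem_insert, Finset.mem_singleton] at h2
      rw [Finset.mem_insert, Finset.mem_singleton]
      rcases h2 with h2 | h2
      · exact Or.inl (Prod.ext hs h2)
      · exact Or.inr (Prod.ext hs h2)
    exact (Finset.card_le_card hsub).trans Finset.card_le_two
  have h4 : (A₁.card : ℝ) ≤ 2 * ∑ e ∈ Tr, F e := by
    have hcard : (A₁.card : ℝ) ≤ 2 * ((A₁.image Θ).card : ℝ) := by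
      exact_mod_cast Finset.card_le_mul_card_image A₁ 2 hfib
    have himg : ((A₁.image Θ).card : ℝ) ≤ ∑ y ∈ A₁.image Θ, F y := by
      rw [← mul_one ((A₁.image Θ).card : ℝ), ← nsmul_eq_mul, ← Finset.sum_const]
      refine Finset.sum_le_sum fun y hy => ?_
      obtain ⟨e, he, rfl⟩ := Finset.mem_image.1 hy
      exact (hch e he).2.1
    have himgT : ∑ y ∈ A₁.image Θ, F y ≤ ∑ e ∈ Tr, F e :=
      Finset.sum_le_sum_of_subset_of_nonneg (fun y hy => by
        obtain ⟨e, he, rfl⟩ := Finset.mem_image.1 hy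
        exact (hch e he).1) fun e _ _ => Finset.sum_nonneg fun j' _ => by positivity
    linarith
  -- assemble
  linarith

/-! ## Statics: the explicit one-window event with a velocity weight -/

/-- **The lift-in-swept-tube window event with a velocity weight.**  For `σ ≤ 1/2`, constant profiles `a, θ > 0`,
`u`, labels `i ≠ j` with a canonical pair law at most `C_p ×` Haar measure on the events of `xᵢ − xⱼ` (`hpair`), a
measurable swept-tube family `S` of volume `≤ 4 ε² h ‖v‖` (`hSm`, `hSvol`) and the minimal-image lift inequality
(`hlift`), the homogeneous Gibbs law integrates a measurable weight `A(vᵢ, vⱼ)` over the EXPLICIT window event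
"a lattice translate of `reprSym(xᵢ − xⱼ)` lies in `S(vⱼ − vᵢ)`" to at most
`C_p · 4 ε² h · ∫ ‖p.2 − p.1‖ A(p) d(N(u,θ) ⊗ N(u,θ))(p)` (the bound of `exists_windowEvent_of_pairBound`, whose event
this is). [folklore] -/
theorem lintegral_windowEvent_velWeight_le {σ : ℝ} (hσ2 : σ ≤ 1 / 2) {a θ : ℝ} (ha : 0 < a)
    (hθ : 0 < θ) (u : V3) {N : ℕ} (Φ : HardSphereFlow (Torus.geometry (Fin 3)) (hsDiameter σ N) (N + 1))
    {h : ℝ} (hh : 0 ≤ h) {i j : Fin (N + 1)} (hij : i ≠ j) {Cp : ℝ≥0∞}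
    (hpair : ∀ T : Set T3, MeasurableSet T →
      posGibbsMeasure (fun _ : T3 => (1 : ℝ)) (hsDiameter σ N) (N + 1) {x | x i - x j ∈ T} ≤ Cp * volume T)
    {S : V3 → Set V3} (hSm : MeasurableSet {q : V3 × V3 | q.1 ∈ S q.2})
    (hSvol : ∀ u, volume (S u) ≤ ENNReal.ofReal (4 * hsDiameter σ N ^ 2 * h * ‖u‖))
    (hlift : ∀ B : Set V3, MeasurableSet B →
      volume {x : T3 | ∃ k : Fin 3 → ℤ, Torus.reprSym x + Torus.latticeVec k ∈ B} ≤ volume B)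
    {A : V3 × V3 → ℝ≥0∞} (hA : Measurable A) :
    ∫⁻ w, {w : Config (N + 1) (Fin 3) T3 | ∃ k : Fin 3 → ℤ,
        Torus.reprSym ((w i).1 - (w j).1) + Torus.latticeVec k ∈ S ((w j).2 - (w i).2)}.indicator
          (fun w => A ((w i).2, (w j).2)) w ∂(localGibbsLaw σ (fun _ => a) (fun _ => u) (fun _ => θ) N Φ) ≤
      Cp * ENNReal.ofReal (4 * hsDiameter σ N ^ 2 * h) *
        ∫⁻ p, ENNReal.ofReal ‖p.2 - p.1‖ * A p ∂((gaussMeasure u θ).prod (gaussMeasure u θ)) := by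
  -- adapted from `exists_windowEvent_of_pairBound` (`CollisionFluxMeanBound`), for its own (explicit) event
  set ε := hsDiameter σ N with hεdef
  set ψ : (Fin 3 → ℤ) → Config (N + 1) (Fin 3) T3 → V3 × V3 := fun k w =>
    (Torus.reprSym ((w i).1 - (w j).1) + Torus.latticeVec k, (w j).2 - (w i).2) with hψ
  have hψm : ∀ k, Measurable (ψ k) := by
    intro k
    refine Measurable.prodMk ?_ ?_
    · exact (Torus.measurable_reprSym.comp
        ((measurable_pi_apply i).fst.sub (measurable_pi_apply j).fst)).add_const _
    · exact (measurable_pi_apply j).snd.sub (measurable_pi_apply i).snd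
  set E : Set (Config (N + 1) (Fin 3) T3) := {w | ∃ k : Fin 3 → ℤ,
    Torus.reprSym ((w i).1 - (w j).1) + Torus.latticeVec k ∈ S ((w j).2 - (w i).2)} with hE
  have hEeq : E = ⋃ k, ψ k ⁻¹' {q : V3 × V3 | q.1 ∈ S q.2} := by
    ext w; simp only [hE, hψ, mem_setOf_eq, mem_iUnion, mem_preimage]
  have hEm : MeasurableSet E := by
    rw [hEeq]; exact MeasurableSet.iUnion fun k => hSm.preimage (hψm k)
  have hSu : ∀ v : V3, MeasurableSet (S v) := fun v =>
    hSm.preimage (measurable_id.prodMk measurable_const)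
  set T : (Fin (N + 1) → V3) → Set T3 := fun v =>
    {p | ∃ k : Fin 3 → ℤ, Torus.reprSym p + Torus.latticeVec k ∈ S (v j - v i)} with hT
  have hTm : ∀ v, MeasurableSet (T v) := by
    intro v
    have : T v = ⋃ k : Fin 3 → ℤ, (fun p : T3 => Torus.reprSym p + Torus.latticeVec k) ⁻¹'
        S (v j - v i) := by
      ext p; simp only [hT, mem_setOf_eq, mem_iUnion, mem_preimage]
    rw [this]
    exact MeasurableSet.iUnion fun k => (hSu _).preimage (Torus.measurable_reprSym.add_const _)
  have hTvol : ∀ v, volume (T v) ≤ ENNReal.ofReal (4 * ε ^ 2 * h * ‖v j - v i‖) := fun v =>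
    (hlift _ (hSu _)).trans (hSvol _)
  set F : Config (N + 1) (Fin 3) T3 → ℝ≥0∞ := E.indicator fun w => A ((w i).2, (w j).2) with hF
  have hAm : Measurable fun w : Config (N + 1) (Fin 3) T3 => A ((w i).2, (w j).2) :=
    hA.comp ((measurable_pi_apply i).snd.prodMk (measurable_pi_apply j).snd)
  have hFm : Measurable F := hAm.indicator hEm
  set Q := posGibbsMeasure (fun _ : T3 => a) ε (N + 1) with hQ
  set Γ : Measure (Fin (N + 1) → V3) := Measure.pi fun _ => gaussMeasure u θ with hΓ
  have hlaw : localGibbsLaw σ (fun _ => a) (fun _ => u) (fun _ => θ) N Φ = (Q.prod Γ).map zipConfig := by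
    rw [localGibbsLaw_eq, localGibbsMeasure_rung0_eq_map σ ha.le hθ u N]
  haveI : IsProbabilityMeasure Q :=
    isProbabilityMeasure_posGibbsMeasure continuous_const (fun _ => ha) hσ2 N
  haveI : IsProbabilityMeasure Γ := by rw [hΓ]; infer_instance
  have hsec : ∀ v : Fin (N + 1) → V3,
      ∫⁻ x, F (zipConfig (x, v)) ∂Q ≤ A (v i, v j) * (Cp * ENNReal.ofReal (4 * ε ^ 2 * h * ‖v j - v i‖)) := by
    intro v
    have hle : ∀ x, F (zipConfig (x, v)) ≤ {x : Fin (N + 1) → T3 | x i - x j ∈ T v}.indicator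
        (fun _ => A (v i, v j)) x := by
      intro x
      by_cases hx : zipConfig (x, v) ∈ E
      · have hx' : x ∈ {x : Fin (N + 1) → T3 | x i - x j ∈ T v} := by
          obtain ⟨k, hk⟩ := hx
          exact ⟨k, by simpa only [zipConfig_apply] using hk⟩
        rw [hF, indicator_of_mem hx, indicator_of_mem hx']
        simp only [zipConfig_apply, le_refl]
      · rw [hF, indicator_of_notMem hx]
        exact bot_le
    calc ∫⁻ x, F (zipConfig (x, v)) ∂Q
        ≤ ∫⁻ x, {x : Fin (N + 1) → T3 | x i - x j ∈ T v}.indicator (fun _ => A (v i, v j)) x ∂Q :=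
          lintegral_mono hle
      _ ≤ A (v i, v j) * Q {x | x i - x j ∈ T v} := lintegral_indicator_const_le _ _
      _ ≤ A (v i, v j) * (Cp * volume (T v)) := by
          have hQ' : Q {x | x i - x j ∈ T v} ≤ Cp * volume (T v) := by
            rw [hQ, posGibbsMeasure_const_eq_one ha]
            exact hpair _ (hTm v)
          gcongr
      _ ≤ A (v i, v j) * (Cp * ENNReal.ofReal (4 * ε ^ 2 * h * ‖v j - v i‖)) := by
          gcongr
          exact hTvol v
  calc ∫⁻ w, F w ∂(localGibbsLaw σ (fun _ => a) (fun _ => u) (fun _ => θ) N Φ)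
      = ∫⁻ pr, F (zipConfig pr) ∂(Q.prod Γ) := by rw [hlaw, lintegral_map hFm measurable_zipConfig]
    _ = ∫⁻ v, ∫⁻ x, F (zipConfig (x, v)) ∂Q ∂Γ :=
        lintegral_prod_symm _ (hFm.comp measurable_zipConfig).aemeasurable
    _ ≤ ∫⁻ v, A (v i, v j) * (Cp * ENNReal.ofReal (4 * ε ^ 2 * h * ‖v j - v i‖)) ∂Γ := lintegral_mono hsec
    _ = ∫⁻ p, A p * (Cp * ENNReal.ofReal (4 * ε ^ 2 * h * ‖p.2 - p.1‖))
          ∂((gaussMeasure u θ).prod (gaussMeasure u θ)) := by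
        rw [hΓ]
        exact lintegral_pi_pair (gaussMeasure u θ) hij
          (f := fun p : V3 × V3 => A p * (Cp * ENNReal.ofReal (4 * ε ^ 2 * h * ‖p.2 - p.1‖)))
          (hA.mul ((by fun_prop : Measurable fun p : V3 × V3 =>
            ENNReal.ofReal (4 * ε ^ 2 * h * ‖p.2 - p.1‖)).const_mul Cp))
    _ = ∫⁻ p, Cp * ENNReal.ofReal (4 * ε ^ 2 * h) * (ENNReal.ofReal ‖p.2 - p.1‖ * A p)
          ∂((gaussMeasure u θ).prod (gaussMeasure u θ)) := by
        refine lintegral_congr fun p => ?_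
        rw [show 4 * ε ^ 2 * h * ‖p.2 - p.1‖ = (4 * ε ^ 2 * h) * ‖p.2 - p.1‖ by ring,
          ENNReal.ofReal_mul (by positivity)]
        ring
    _ = Cp * ENNReal.ofReal (4 * ε ^ 2 * h) *
          ∫⁻ p, ENNReal.ofReal ‖p.2 - p.1‖ * A p ∂((gaussMeasure u θ).prod (gaussMeasure u θ)) :=
        lintegral_const_mul'' _ ((by fun_prop : Measurable fun p : V3 × V3 =>
          ENNReal.ofReal ‖p.2 - p.1‖).mul hA).aemeasurable

/-- Superadditivity of the lower integral over a finite sum (no measurability). [folklore] -/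
private theorem sum_lintegral_le_lintegral_sum {α ι : Type*} [MeasurableSpace α] (μ : Measure α)
    (s : Finset ι) (f : ι → α → ℝ≥0∞) :
    ∑ i ∈ s, ∫⁻ x, f i x ∂μ ≤ ∫⁻ x, ∑ i ∈ s, f i x ∂μ := by
  classical
  induction s using Finset.induction_on with
  | empty => simp
  | insert a s has ih =>
    rw [Finset.sum_insert has]
    calc ∫⁻ x, f a x ∂μ + ∑ i ∈ s, ∫⁻ x, f i x ∂μ ≤ ∫⁻ x, f a x ∂μ + ∫⁻ x, ∑ i ∈ s, f i x ∂μ :=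
          add_le_add le_rfl ih
      _ ≤ ∫⁻ x, (f a x + ∑ i ∈ s, f i x) ∂μ := le_lintegral_add _ _
      _ = ∫⁻ x, ∑ i ∈ insert a s, f i x ∂μ := by
          refine lintegral_congr fun x => ?_
          rw [Finset.sum_insert has]

/-! ## The mean excess count under the homogeneous Gibbs law -/

/-- **Mean number of repeated collisions of tagged spheres in a short window (rung 0).**  For `0 < σ ≤ 1/4`,
constant profiles `a, θ > 0`, `u`, a hard-sphere flow `Φ` of `N + 1` spheres of diameter `ε = hsDiameter σ N` on `𝕋³`
preserving the homogeneous Gibbs law `G_N` (`hstat`), the canonical pair and three-label bounds `hpair` (`≤ 4 vol`) and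
`htriple` (`≤ 8 vol · vol`, Ruelle), swept tubes `htube` and the minimal-image lift inequality `hlift`: for every `T > 0`
the summed mean EXCESS COUNTS (collision times of sphere `i` in `[0, T]` beyond the first, extended by `0` off the good
set) satisfy
`Σ_i ∫ (D_i − 1)₊ dG_N ≤ (128 T² (N+1)² ε² + 1024 T² (N+1)³ ε⁴) · ∫ ‖q.2 − q.1‖² d(N(u,θ) ⊗ N(u,θ))`:
the pathwise charging `sum_ncard_collisionTimesOf_sub_one_le_chargedSums`, the mean window bound
`lintegral_le_liminf_of_le_collisionSum` for the single mark `‖v_m − v_p‖/R + 2 F` (`R = (1/2 − ε)/(2T)`, `F` the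
forward-contact count of window `2T`, pulled back along the backward flights of the window into two-sided tubes,
`exists_latticeVec_mem_twoSidedTube`), and the statics `lintegral_windowEvent_velWeight_le`,
`measure_windowEvent_inter_tubeEvent_le`; the mesh cancels (`M · T/M = T`).  With `(N+1) ε² T ≲ σ² a` both terms are
`O((N+1) a²)`. [folklore] -/
theorem sum_lintegral_ncard_collisionTimesOf_sub_one_le {σ : ℝ} (hσ : 0 < σ) (hσ4 : σ ≤ 1 / 4) {a θ : ℝ}
    (ha : 0 < a) (hθ : 0 < θ) (u : V3) {N : ℕ}
    (Φ : HardSphereFlow (Torus.geometry (Fin 3)) (hsDiameter σ N) (N + 1))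
    (hstat : ∀ t : ℝ, MeasurePreserving (Φ.flow t) (localGibbsLaw σ (fun _ => a) (fun _ => u) (fun _ => θ) N Φ)
      (localGibbsLaw σ (fun _ => a) (fun _ => u) (fun _ => θ) N Φ))
    (hpair : ∀ i j : Fin (N + 1), i ≠ j → ∀ S : Set T3, MeasurableSet S →
      posGibbsMeasure (fun _ : T3 => (1 : ℝ)) (hsDiameter σ N) (N + 1) {x | x i - x j ∈ S} ≤ 4 * volume S)
    (htriple : ∀ i j k : Fin (N + 1), i ≠ j → i ≠ k → j ≠ k → ∀ S S' : Set T3, MeasurableSet S →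
      MeasurableSet S' → posGibbsMeasure (fun _ : T3 => (1 : ℝ)) (hsDiameter σ N) (N + 1)
        {x | x j - x i ∈ S ∧ x k - x i ∈ S'} ≤ 8 * (volume S * volume S'))
    (htube : ∀ h : ℝ, 0 ≤ h → ∃ S : V3 → Set V3, MeasurableSet {q : V3 × V3 | q.1 ∈ S q.2} ∧
      (∀ u, volume (S u) ≤ ENNReal.ofReal (4 * hsDiameter σ N ^ 2 * h * ‖u‖)) ∧
      ∀ (u r : V3) (s : ℝ), hsDiameter σ N ≤ ‖r‖ → s ∈ Icc 0 h → ‖r + s • u‖ = hsDiameter σ N → r ∈ S u)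
    (hlift : ∀ B : Set V3, MeasurableSet B →
      volume {x : T3 | ∃ k : Fin 3 → ℤ, Torus.reprSym x + Torus.latticeVec k ∈ B} ≤ volume B)
    {T : ℝ} (hT : 0 < T) :
    ∑ i : Fin (N + 1), ∫⁻ z, Φ.good.indicator (fun z =>
        ((((collisionTimesOf (Torus.geometry (Fin 3)) (hsDiameter σ N) (fun t => Φ.flow t z) i ∩
          Icc 0 T).ncard - 1 : ℕ) : ℝ≥0∞))) z
        ∂(localGibbsLaw σ (fun _ => a) (fun _ => u) (fun _ => θ) N Φ) ≤
      ENNReal.ofReal (128 * T ^ 2 * ((N + 1 : ℕ) : ℝ) ^ 2 * hsDiameter σ N ^ 2 +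
          1024 * T ^ 2 * ((N + 1 : ℕ) : ℝ) ^ 3 * hsDiameter σ N ^ 4) *
        ∫⁻ q, ENNReal.ofReal (‖q.2 - q.1‖ ^ 2) ∂((gaussMeasure u θ).prod (gaussMeasure u θ)) := by
  classical
  have hε : 0 < hsDiameter σ N := hsDiameter_pos hσ N
  have hε4 : hsDiameter σ N ≤ 1 / 4 := (hsDiameter_le hσ.le N).trans hσ4
  have hε2 : hsDiameter σ N < 1 / 2 := by linarith
  have hσ2 : σ ≤ 1 / 2 := by linarith
  set P := localGibbsLaw σ (fun _ => a) (fun _ => u) (fun _ => θ) N Φ with hPdef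
  have hP : P Φ.goodᶜ = 0 := by
    rw [hPdef, localGibbsLaw_eq]
    exact localGibbsMeasure_absolutelyContinuous σ _ _ _ N Φ Φ.measure_compl_good
  set m₂ := ∫⁻ q, ENNReal.ofReal (‖q.2 - q.1‖ ^ 2) ∂((gaussMeasure u θ).prod (gaussMeasure u θ)) with hm₂
  set ℓ : ℝ := 2 * T with hℓdef
  have hℓ : 0 < ℓ := by positivity
  set R : ℝ := (1 / 2 - hsDiameter σ N) / ℓ with hRdef
  have hR : 0 < R := div_pos (by linarith) hℓ
  have hRinv : 1 / R ≤ 8 * T := by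
    rw [hRdef, one_div_div, div_le_iff₀ (by linarith)]
    nlinarith
  -- tube families: length `ℓ`, and length `T / M` for every mesh
  obtain ⟨Sℓ, hSℓm, hSℓvol, hSℓ⟩ := htube ℓ hℓ.le
  have hhM : ∀ M : ℕ, 0 ≤ T / M := fun M => div_nonneg hT.le (Nat.cast_nonneg M)
  choose Sh hShm hShvol hSh using fun M : ℕ => htube (T / M) (hhM M)
  -- events, the mark and its majorants
  set E : ℕ → Fin (N + 1) → Fin (N + 1) → Set (Config (N + 1) (Fin 3) T3) := fun M p m =>
    {w | ∃ k : Fin 3 → ℤ, Torus.reprSym ((w m).1 - (w p).1) + Torus.latticeVec k ∈ Sh M ((w p).2 - (w m).2)}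
    with hEdef
  set E' : ℕ → Fin (N + 1) → Fin (N + 1) → Set (Config (N + 1) (Fin 3) T3) := fun M p j' =>
    {w | ∃ k : Fin 3 → ℤ, Torus.reprSym ((w j').1 - (w p).1) + Torus.latticeVec k ∈
      Sℓ ((w j').2 - (w p).2) ∪ Sh M ((w p).2 - (w j').2)} with hE'def
  set bv : Config (N + 1) (Fin 3) T3 → Fin (N + 1) → Fin (N + 1) → ℝ≥0∞ := fun w p m =>
    ENNReal.ofReal (‖(w m).2 - (w p).2‖ / R) with hbvdef
  set Ff : Config (N + 1) (Fin 3) T3 → Fin (N + 1) → Fin (N + 1) → ℝ≥0∞ := fun w p m =>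
    ∑ j' : Fin (N + 1), if j' ≠ p ∧ j' ≠ m ∧ ∃ t ∈ Ioo 0 ℓ,
      ‖Torus.reprSym (((w j').1 - (w p).1) + Torus.proj (t • ((w j').2 - (w p).2)))‖ = (hsDiameter σ N)
      then (1 : ℝ≥0∞) else 0 with hFfdef
  set Fft : ℕ → Config (N + 1) (Fin 3) T3 → Fin (N + 1) → Fin (N + 1) → ℝ≥0∞ := fun M w p m =>
    ∑ j' : Fin (N + 1), if j' ≠ p ∧ j' ≠ m then (E M p m ∩ E' M p j').indicator 1 w else 0 with hFftdef
  set F : Config (N + 1) (Fin 3) T3 → Fin (N + 1) → Fin (N + 1) → ℝ≥0∞ := fun w p m =>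
    bv w p m + 2 * Ff w p m with hFdef
  set Ft : ℕ → Config (N + 1) (Fin 3) T3 → Fin (N + 1) → Fin (N + 1) → ℝ≥0∞ := fun M w p m =>
    bv w p m + 2 * Fft M w p m with hFtdef
  -- measurability
  have hψm : ∀ (i j i' j'' : Fin (N + 1)) (k : Fin 3 → ℤ), Measurable fun w : Config (N + 1) (Fin 3) T3 =>
      (Torus.reprSym ((w i).1 - (w j).1) + Torus.latticeVec k, (w i').2 - (w j'').2) := by
    intro i j i' j'' k
    refine Measurable.prodMk ?_ ?_
    · exact (Torus.measurable_reprSym.comp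
        ((measurable_pi_apply i).fst.sub (measurable_pi_apply j).fst)).add_const _
    · exact (measurable_pi_apply i').snd.sub (measurable_pi_apply j'').snd
  have hEm : ∀ M p m, MeasurableSet (E M p m) := by
    intro M p m
    have h1 : E M p m = ⋃ k : Fin 3 → ℤ, (fun w : Config (N + 1) (Fin 3) T3 =>
        (Torus.reprSym ((w m).1 - (w p).1) + Torus.latticeVec k, (w p).2 - (w m).2)) ⁻¹'
          {q : V3 × V3 | q.1 ∈ Sh M q.2} := by
      ext w; simp only [hEdef, mem_setOf_eq, mem_iUnion, mem_preimage]
    rw [h1]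
    exact MeasurableSet.iUnion fun k => (hShm M).preimage (hψm m p p m k)
  have hE'm : ∀ M p j', MeasurableSet (E' M p j') := by
    intro M p j'
    have h2 : E' M p j' = ⋃ k : Fin 3 → ℤ, ((fun w : Config (N + 1) (Fin 3) T3 =>
          (Torus.reprSym ((w j').1 - (w p).1) + Torus.latticeVec k, (w j').2 - (w p).2)) ⁻¹'
            {q : V3 × V3 | q.1 ∈ Sℓ q.2} ∪
          (fun w : Config (N + 1) (Fin 3) T3 =>
            (Torus.reprSym ((w j').1 - (w p).1) + Torus.latticeVec k, (w p).2 - (w j').2)) ⁻¹'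
            {q : V3 × V3 | q.1 ∈ Sh M q.2}) := by
      ext w; simp only [hE'def, mem_setOf_eq, mem_iUnion, mem_preimage, mem_union]
    rw [h2]
    exact MeasurableSet.iUnion fun k => (hSℓm.preimage (hψm j' p j' p k)).union ((hShm M).preimage (hψm j' p p j' k))
  have hsm : ∀ M p m j', Measurable fun w : Config (N + 1) (Fin 3) T3 =>
      (if j' ≠ p ∧ j' ≠ m then (E M p m ∩ E' M p j').indicator 1 w else 0 : ℝ≥0∞) := by
    intro M p m j'
    by_cases hj : j' ≠ p ∧ j' ≠ m
    · simp only [if_pos hj]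
      exact measurable_one.indicator ((hEm M p m).inter (hE'm M p j'))
    · simp only [if_neg hj]
      exact measurable_const
  have hFftm : ∀ M p m, Measurable fun w => Fft M w p m := fun M p m =>
    Finset.measurable_sum _ fun j' _ => hsm M p m j'
  have hbvm : ∀ p m, Measurable fun w => bv w p m := fun p m =>
    (((measurable_pi_apply m).snd.sub (measurable_pi_apply p).snd).norm.div_const R).ennreal_ofReal
  have hFtm : ∀ M p m, Measurable fun w => Ft M w p m := fun M p m =>
    (hbvm p m).add ((hFftm M p m).const_mul 2)
  -- covering property of the window events
  have hEc : ∀ (M : ℕ) (p m : Fin (N + 1)), p ≠ m →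
      ∀ w ∈ hardSphereDomain (Torus.geometry (Fin 3)) (N + 1) (hsDiameter σ N), ∀ t ∈ Icc 0 (T / M),
      ‖(Torus.geometry (Fin 3)).sepVec ((freeFlight (Torus.geometry (Fin 3)) (-t) w p).1)
        ((freeFlight (Torus.geometry (Fin 3)) (-t) w m).1)‖ = (hsDiameter σ N) → w ∈ E M p m := by
    intro M p m hpm w hw t ht hc
    have hc' : ‖(Torus.geometry (Fin 3)).sepVec ((freeFlight (Torus.geometry (Fin 3)) (-t) w m).1)
        ((freeFlight (Torus.geometry (Fin 3)) (-t) w p).1)‖ = (hsDiameter σ N) := by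
      rw [Torus.norm_geometry_sepVec, Torus.euclidDist_comm, ← Torus.norm_geometry_sepVec]
      exact hc
    exact exists_latticeVec_add_mem_of_contact (hSh M) hw hpm.symm ht hc'
  -- the majorants dominate the mark along the window
  have hFt : ∀ (M : ℕ) (p m : Fin (N + 1)), p ≠ m →
      ∀ w ∈ hardSphereDomain (Torus.geometry (Fin 3)) (N + 1) (hsDiameter σ N), ∀ t ∈ Icc 0 (T / M),
      ‖(Torus.geometry (Fin 3)).sepVec ((freeFlight (Torus.geometry (Fin 3)) (-t) w p).1)
        ((freeFlight (Torus.geometry (Fin 3)) (-t) w m).1)‖ = (hsDiameter σ N) →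
        F (freeFlight (Torus.geometry (Fin 3)) (-t) w) p m ≤ Ft M w p m := by
    intro M p m hpm w hw t ht hc
    have hb : bv (freeFlight (Torus.geometry (Fin 3)) (-t) w) p m = bv w p m := by
      simp only [hbvdef, freeFlight_apply]
    refine add_le_add hb.le (mul_le_mul_of_nonneg_left (Finset.sum_le_sum fun j' _ => ?_) bot_le)
    by_cases hcond : j' ≠ p ∧ j' ≠ m ∧ ∃ t' ∈ Ioo 0 ℓ,
        ‖Torus.reprSym ((((freeFlight (Torus.geometry (Fin 3)) (-t) w) j').1 -
          ((freeFlight (Torus.geometry (Fin 3)) (-t) w) p).1) +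
          Torus.proj (t' • (((freeFlight (Torus.geometry (Fin 3)) (-t) w) j').2 -
            ((freeFlight (Torus.geometry (Fin 3)) (-t) w) p).2)))‖ = (hsDiameter σ N)
    · obtain ⟨hj'p, hj'm, t', ht', hhit⟩ := hcond
      rw [if_pos ⟨hj'p, hj'm, t', ht', hhit⟩, if_pos ⟨hj'p, hj'm⟩]
      have hmem : w ∈ E M p m ∩ E' M p j' :=
        ⟨hEc M p m hpm w hw t ht hc, exists_latticeVec_mem_twoSidedTube (hSh M) hSℓ hw hj'p ht ht' hhit⟩
      rw [indicator_of_mem hmem, Pi.one_apply]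
    · rw [if_neg hcond]
      exact bot_le
  -- the functional and its pathwise domination by the collision sum of the mark
  set f : Config (N + 1) (Fin 3) T3 → ℝ≥0∞ := fun z => Φ.good.indicator (fun z => ∑ i : Fin (N + 1),
    ((((collisionTimesOf (Torus.geometry (Fin 3)) (hsDiameter σ N) (fun t => Φ.flow t z) i ∩
      Icc 0 T).ncard - 1 : ℕ) : ℝ≥0∞))) z with hfdef
  have hf : ∀ z ∈ Φ.good, f z ≤ ∑ᶠ s ∈ collisionTimes (Torus.geometry (Fin 3)) (hsDiameter σ N)
        (fun t => Φ.flow t z) ∩ Icc 0 T,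
      ∑ i : Fin (N + 1), ∑ j : Fin (N + 1),
        (if i ≠ j ∧ ‖(Torus.geometry (Fin 3)).sepVec (Φ.flow s z i).1 (Φ.flow s z j).1‖ = hsDiameter σ N
          then F (Φ.flow s z) i j else 0) := by
    intro z hz
    rw [hfdef]
    dsimp only
    rw [indicator_of_mem hz]
    have hfin : (collisionTimes (Torus.geometry (Fin 3)) (hsDiameter σ N) (fun t => Φ.flow t z) ∩
        Icc 0 T).Finite := (Φ.isTrajectory z hz).locFinite 0 T
    have hdom : ∀ s, Φ.flow s z ∈ hardSphereDomain (Torus.geometry (Fin 3)) (N + 1) (hsDiameter σ N) :=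
      fun s => orbit_mem hz s
    -- the real right-hand side of the pathwise charging, as one collision pair sum
    set g : ℝ → Fin (N + 1) → Fin (N + 1) → ℝ := fun s i j =>
      ‖(Φ.flow s z j).2 - (Φ.flow s z i).2‖ / R +
        2 * ∑ j' : Fin (N + 1), (if j' ≠ i ∧ j' ≠ j ∧ ∃ t ∈ Ioo 0 ℓ,
          ‖Torus.reprSym (((Φ.flow s z j').1 - (Φ.flow s z i).1) +
            Torus.proj (t • ((Φ.flow s z j').2 - (Φ.flow s z i).2)))‖ = hsDiameter σ N
          then (1 : ℝ) else 0) with hgdef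
    have hg0 : ∀ s i j, 0 ≤ g s i j := fun s i j => add_nonneg (div_nonneg (norm_nonneg _) hR.le)
      (mul_nonneg zero_le_two (Finset.sum_nonneg fun j' _ => by split_ifs <;> norm_num))
    have hreal : (∑ i : Fin (N + 1), (((collisionTimesOf (Torus.geometry (Fin 3)) (hsDiameter σ N)
        (fun t => Φ.flow t z) i ∩ Icc 0 T).ncard - 1 : ℕ) : ℝ)) ≤
        ∑ s ∈ hfin.toFinset, ∑ p ∈ contactPairs (Torus.geometry (Fin 3)) (hsDiameter σ N) (Φ.flow s z),
          g s p.1 p.2 := by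
      refine (sum_ncard_collisionTimesOf_sub_one_le_chargedSums hz hε2 hT).trans_eq ?_
      rw [← collisionPairSum_eq_finset_sum hfin g, hgdef, collisionPairSum_add hfin,
        collisionPairSum_const_mul hfin]
      rfl
    have hterm : ∀ (s : ℝ) (p q : Fin (N + 1)), ENNReal.ofReal (g s p q) = F (Φ.flow s z) p q := by
      intro s p q
      simp only [hgdef, hFdef, hbvdef, hFfdef]
      rw [ENNReal.ofReal_add (div_nonneg (norm_nonneg _) hR.le)
          (mul_nonneg zero_le_two (Finset.sum_nonneg fun j' _ => by split_ifs <;> norm_num)),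
        ENNReal.ofReal_mul zero_le_two, ENNReal.ofReal_ofNat,
        ENNReal.ofReal_sum_of_nonneg fun j' _ => by split_ifs <;> norm_num]
      congr 2
      refine Finset.sum_congr rfl fun j' _ => ?_
      split_ifs <;> simp
    have hcast : (∑ i : Fin (N + 1), ((((collisionTimesOf (Torus.geometry (Fin 3)) (hsDiameter σ N)
        (fun t => Φ.flow t z) i ∩ Icc 0 T).ncard - 1 : ℕ) : ℝ≥0∞))) =
        ENNReal.ofReal (∑ i : Fin (N + 1), (((collisionTimesOf (Torus.geometry (Fin 3)) (hsDiameter σ N)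
          (fun t => Φ.flow t z) i ∩ Icc 0 T).ncard - 1 : ℕ) : ℝ)) := by
      rw [ENNReal.ofReal_sum_of_nonneg fun i _ => Nat.cast_nonneg _]
      simp only [ENNReal.ofReal_natCast]
    rw [hcast, finsum_mem_eq_finite_toFinset_sum _ hfin]
    calc ENNReal.ofReal (∑ i : Fin (N + 1), (((collisionTimesOf (Torus.geometry (Fin 3)) (hsDiameter σ N)
          (fun t => Φ.flow t z) i ∩ Icc 0 T).ncard - 1 : ℕ) : ℝ))
        ≤ ENNReal.ofReal (∑ s ∈ hfin.toFinset,
            ∑ p ∈ contactPairs (Torus.geometry (Fin 3)) (hsDiameter σ N) (Φ.flow s z), g s p.1 p.2) :=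
          ENNReal.ofReal_le_ofReal hreal
      _ = ∑ s ∈ hfin.toFinset, ∑ p ∈ contactPairs (Torus.geometry (Fin 3)) (hsDiameter σ N) (Φ.flow s z),
            ENNReal.ofReal (g s p.1 p.2) := by
          rw [ENNReal.ofReal_sum_of_nonneg fun s _ => Finset.sum_nonneg fun p _ => hg0 _ _ _]
          exact Finset.sum_congr rfl fun s _ => ENNReal.ofReal_sum_of_nonneg fun p _ => hg0 _ _ _
      _ = ∑ s ∈ hfin.toFinset, ∑ p ∈ contactPairs (Torus.geometry (Fin 3)) (hsDiameter σ N) (Φ.flow s z),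
            F (Φ.flow s z) p.1 p.2 := by
          simp only [hterm]
      _ = _ := by
          refine Finset.sum_congr rfl fun s _ => ?_
          exact sum_contactPairs_eq (hdom s) _
  -- the abstract mean window bound
  have hgen := lintegral_le_liminf_of_le_collisionSum Φ P hstat hP hT F E hEm hEc Ft hFtm hFt f hf
  -- the mean of one window
  have hB : ∀ M : ℕ, 0 < M → T / M ≤ ℓ → (M : ℝ≥0∞) * ∫⁻ w, ∑ p, ∑ m,
      (if p ≠ m then (E M p m).indicator (fun w => Ft M w p m) w else 0) ∂P ≤
        ENNReal.ofReal (128 * T ^ 2 * ((N + 1 : ℕ) : ℝ) ^ 2 * hsDiameter σ N ^ 2 +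
          1024 * T ^ 2 * ((N + 1 : ℕ) : ℝ) ^ 3 * hsDiameter σ N ^ 4) * m₂ := by
    intro M hM hMℓ
    have hM' : (0 : ℝ) < M := by exact_mod_cast hM
    set x : ℝ := T / M with hxdef
    have hx0 : 0 ≤ x := hhM M
    have hMx : (M : ℝ) * x = T := by rw [hxdef]; field_simp
    set cM : ℝ := 16 * hsDiameter σ N ^ 2 * x * (1 / R) +
      256 * ((N + 1 : ℕ) : ℝ) * hsDiameter σ N ^ 4 * x * (ℓ + x) with hcM
    have hcM0 : 0 ≤ cM := by positivity
    set c : ℝ≥0∞ := ENNReal.ofReal (128 * hsDiameter σ N ^ 4 * x * (ℓ + x)) * m₂ with hc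
    -- one ordered pair: the velocity part and the forward-contact part
    have hterm : ∀ p m : Fin (N + 1), p ≠ m →
        ∫⁻ w, (E M p m).indicator (fun w => Ft M w p m) w ∂P ≤ ENNReal.ofReal cM * m₂ := by
      intro p m hpm
      have hsplit : ∀ w, (E M p m).indicator (fun w => Ft M w p m) w =
          (E M p m).indicator (fun w => bv w p m) w + 2 * ∑ j' : Fin (N + 1),
            (if j' ≠ p ∧ j' ≠ m then (E M p m ∩ E' M p j').indicator 1 w else 0 : ℝ≥0∞) := by
        intro w
        by_cases hw : w ∈ E M p m
        · rw [indicator_of_mem hw, indicator_of_mem hw]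
        · have h0 : ∑ j' : Fin (N + 1),
              (if j' ≠ p ∧ j' ≠ m then (E M p m ∩ E' M p j').indicator 1 w else 0 : ℝ≥0∞) = 0 := by
            refine Finset.sum_eq_zero fun j' _ => ?_
            split_ifs
            · exact indicator_of_notMem (fun h => hw h.1) _
            · rfl
          rw [indicator_of_notMem hw, indicator_of_notMem hw, h0, mul_zero, zero_add]
      -- the velocity part
      have hvel : ∫⁻ w, (E M p m).indicator (fun w => bv w p m) w ∂P ≤
          ENNReal.ofReal (16 * hsDiameter σ N ^ 2 * x * (1 / R)) * m₂ := by
        have h1 : ∫⁻ w, (E M p m).indicator (fun w => bv w p m) w ∂P ≤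
            4 * ENNReal.ofReal (4 * hsDiameter σ N ^ 2 * x) *
              ∫⁻ q, ENNReal.ofReal ‖q.2 - q.1‖ * ENNReal.ofReal (‖q.1 - q.2‖ / R)
                ∂((gaussMeasure u θ).prod (gaussMeasure u θ)) :=
          lintegral_windowEvent_velWeight_le hσ2 ha hθ u Φ hx0 (Ne.symm hpm) (hpair m p (Ne.symm hpm))
            (hShm M) (hShvol M) hlift (A := fun q : V3 × V3 => ENNReal.ofReal (‖q.1 - q.2‖ / R)) (by fun_prop)
        have h2 : ∫⁻ q, ENNReal.ofReal ‖q.2 - q.1‖ * ENNReal.ofReal (‖q.1 - q.2‖ / R)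
            ∂((gaussMeasure u θ).prod (gaussMeasure u θ)) = ENNReal.ofReal (1 / R) * m₂ := by
          rw [hm₂, ← lintegral_const_mul _ (by fun_prop)]
          refine lintegral_congr fun q => ?_
          rw [norm_sub_rev q.1 q.2, ← ENNReal.ofReal_mul (norm_nonneg _), ← ENNReal.ofReal_mul (by positivity)]
          congr 1
          field_simp
        rw [h2] at h1
        refine h1.trans (le_of_eq ?_)
        rw [← ENNReal.ofReal_ofNat 4, ← mul_assoc, ← ENNReal.ofReal_mul (by norm_num), ← mul_assoc,
          ← ENNReal.ofReal_mul (by positivity)]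
        congr 2
        ring
      -- the forward-contact part
      have hfwd : ∫⁻ w, ∑ j' : Fin (N + 1),
          (if j' ≠ p ∧ j' ≠ m then (E M p m ∩ E' M p j').indicator 1 w else 0 : ℝ≥0∞) ∂P ≤
          ((N + 1 : ℕ) : ℝ≥0∞) * c := by
        rw [lintegral_finsetSum _ fun j' _ => hsm M p m j']
        calc ∑ j' : Fin (N + 1), ∫⁻ w, (if j' ≠ p ∧ j' ≠ m then (E M p m ∩ E' M p j').indicator 1 w else 0 : ℝ≥0∞) ∂P
            ≤ ∑ _j' : Fin (N + 1), c := by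
              refine Finset.sum_le_sum fun j' _ => ?_
              by_cases hj : j' ≠ p ∧ j' ≠ m
              · simp only [if_pos hj]
                rw [lintegral_indicator_one ((hEm M p m).inter (hE'm M p j'))]
                exact measure_windowEvent_inter_tubeEvent_le hσ2 ha hθ u Φ hpm (Ne.symm hj.1)
                  (htriple p m j' hpm (Ne.symm hj.1) (Ne.symm hj.2)) hx0 hℓ.le (hShm M) hSℓm (hShvol M) hSℓvol
                  hlift
              · simp only [if_neg hj, lintegral_const, zero_mul]
                exact bot_le
          _ = ((N + 1 : ℕ) : ℝ≥0∞) * c := by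
              rw [Finset.sum_const, Finset.card_univ, Fintype.card_fin, nsmul_eq_mul]
      calc ∫⁻ w, (E M p m).indicator (fun w => Ft M w p m) w ∂P
          = ∫⁻ w, ((E M p m).indicator (fun w => bv w p m) w + 2 * ∑ j' : Fin (N + 1),
              (if j' ≠ p ∧ j' ≠ m then (E M p m ∩ E' M p j').indicator 1 w else 0 : ℝ≥0∞)) ∂P :=
            lintegral_congr hsplit
        _ = ∫⁻ w, (E M p m).indicator (fun w => bv w p m) w ∂P + 2 * ∫⁻ w, ∑ j' : Fin (N + 1),
              (if j' ≠ p ∧ j' ≠ m then (E M p m ∩ E' M p j').indicator 1 w else 0 : ℝ≥0∞) ∂P := by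
            rw [lintegral_add_left ((hbvm p m).indicator (hEm M p m)),
              lintegral_const_mul _ (Finset.measurable_sum _ fun j' _ => hsm M p m j')]
        _ ≤ ENNReal.ofReal (16 * hsDiameter σ N ^ 2 * x * (1 / R)) * m₂ + 2 * (((N + 1 : ℕ) : ℝ≥0∞) * c) :=
            add_le_add hvel (mul_le_mul_of_nonneg_left hfwd bot_le)
        _ = ENNReal.ofReal cM * m₂ := by
            rw [hcM, hc, ENNReal.ofReal_add (by positivity) (by positivity), add_mul]
            congr 1
            rw [show (256 : ℝ) * ((N + 1 : ℕ) : ℝ) * hsDiameter σ N ^ 4 * x * (ℓ + x) =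
                2 * (((N + 1 : ℕ) : ℝ) * (128 * hsDiameter σ N ^ 4 * x * (ℓ + x))) by ring,
              ENNReal.ofReal_mul zero_le_two, ENNReal.ofReal_ofNat, ENNReal.ofReal_mul (Nat.cast_nonneg _),
              ENNReal.ofReal_natCast]
            ring
    have hmeas : ∀ p m : Fin (N + 1), Measurable fun w : Config (N + 1) (Fin 3) T3 =>
        (if p ≠ m then (E M p m).indicator (fun w => Ft M w p m) w else 0) := by
      intro p m
      by_cases hpm : p ≠ m
      · simp only [if_pos hpm]; exact (hFtm M p m).indicator (hEm M p m)
      · simp only [if_neg hpm]; exact measurable_const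
    -- the real bookkeeping: `M · (T/M) = T`, `1/R ≤ 8T`, `ℓ + T/M ≤ 4T`
    have hreal : (M : ℝ) * (((N + 1 : ℕ) : ℝ) ^ 2 * cM) ≤
        128 * T ^ 2 * ((N + 1 : ℕ) : ℝ) ^ 2 * hsDiameter σ N ^ 2 +
          1024 * T ^ 2 * ((N + 1 : ℕ) : ℝ) ^ 3 * hsDiameter σ N ^ 4 := by
      have h1 : (M : ℝ) * (((N + 1 : ℕ) : ℝ) ^ 2 * cM) =
          ((N + 1 : ℕ) : ℝ) ^ 2 * 16 * hsDiameter σ N ^ 2 * ((M : ℝ) * x) * (1 / R) +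
            ((N + 1 : ℕ) : ℝ) ^ 3 * 256 * hsDiameter σ N ^ 4 * ((M : ℝ) * x) * (ℓ + x) := by
        rw [hcM]; push_cast; ring
      rw [h1, hMx]
      have hℓx : ℓ + x ≤ 4 * T := by rw [hℓdef] at hMℓ ⊢; linarith
      have hA : ((N + 1 : ℕ) : ℝ) ^ 2 * 16 * hsDiameter σ N ^ 2 * T * (1 / R) ≤
          ((N + 1 : ℕ) : ℝ) ^ 2 * 16 * hsDiameter σ N ^ 2 * T * (8 * T) :=
        mul_le_mul_of_nonneg_left hRinv (by positivity)
      have hB' : ((N + 1 : ℕ) : ℝ) ^ 3 * 256 * hsDiameter σ N ^ 4 * T * (ℓ + x) ≤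
          ((N + 1 : ℕ) : ℝ) ^ 3 * 256 * hsDiameter σ N ^ 4 * T * (4 * T) :=
        mul_le_mul_of_nonneg_left hℓx (by positivity)
      nlinarith
    calc (M : ℝ≥0∞) * ∫⁻ w, ∑ p, ∑ m, (if p ≠ m then (E M p m).indicator (fun w => Ft M w p m) w else 0) ∂P
        = (M : ℝ≥0∞) * ∑ p, ∑ m, ∫⁻ w, (if p ≠ m then (E M p m).indicator (fun w => Ft M w p m) w else 0) ∂P := by
          congr 1
          rw [lintegral_finsetSum _ fun p _ => Finset.measurable_sum _ fun m _ => hmeas p m]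
          exact Finset.sum_congr rfl fun p _ => lintegral_finsetSum _ fun m _ => hmeas p m
      _ ≤ (M : ℝ≥0∞) * ∑ _p : Fin (N + 1), ∑ _m : Fin (N + 1), ENNReal.ofReal cM * m₂ := by
          gcongr with p _ m _
          by_cases hpm : p ≠ m
          · simp only [if_pos hpm]; exact hterm p m hpm
          · simp only [if_neg hpm, lintegral_const, zero_mul]; exact bot_le
      _ = ENNReal.ofReal ((M : ℝ) * (((N + 1 : ℕ) : ℝ) ^ 2 * cM)) * m₂ := by
          simp only [Finset.sum_const, Finset.card_univ, Fintype.card_fin, nsmul_eq_mul]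
          rw [← ENNReal.ofReal_natCast M, ← ENNReal.ofReal_natCast (N + 1), ← mul_assoc, ← mul_assoc, ← mul_assoc,
            ← ENNReal.ofReal_mul (Nat.cast_nonneg _), ← ENNReal.ofReal_mul (by positivity),
            ← ENNReal.ofReal_mul (by positivity)]
          congr 2
          ring
      _ ≤ _ := mul_le_mul_of_nonneg_right (ENNReal.ofReal_le_ofReal hreal) bot_le
  -- eventually in the mesh, hence frequently
  have hfreq : ∃ᶠ M : ℕ in atTop, (M : ℝ≥0∞) * ∫⁻ w, ∑ p, ∑ m,
      (if p ≠ m then (E M p m).indicator (fun w => Ft M w p m) w else 0) ∂P ≤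
        ENNReal.ofReal (128 * T ^ 2 * ((N + 1 : ℕ) : ℝ) ^ 2 * hsDiameter σ N ^ 2 +
          1024 * T ^ 2 * ((N + 1 : ℕ) : ℝ) ^ 3 * hsDiameter σ N ^ 4) * m₂ := by
    refine Eventually.frequently ?_
    filter_upwards [eventually_ge_atTop 1] with M hM
    refine hB M hM ?_
    rw [hℓdef, div_le_iff₀ (by exact_mod_cast hM : (0 : ℝ) < M)]
    have : (1 : ℝ) ≤ M := by exact_mod_cast hM
    nlinarith
  -- assemble
  calc ∑ i : Fin (N + 1), ∫⁻ z, Φ.good.indicator (fun z =>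
          ((((collisionTimesOf (Torus.geometry (Fin 3)) (hsDiameter σ N) (fun t => Φ.flow t z) i ∩
            Icc 0 T).ncard - 1 : ℕ) : ℝ≥0∞))) z ∂P
      ≤ ∫⁻ z, ∑ i : Fin (N + 1), Φ.good.indicator (fun z =>
          ((((collisionTimesOf (Torus.geometry (Fin 3)) (hsDiameter σ N) (fun t => Φ.flow t z) i ∩
            Icc 0 T).ncard - 1 : ℕ) : ℝ≥0∞))) z ∂P := sum_lintegral_le_lintegral_sum P _ _
    _ = ∫⁻ z, f z ∂P := by
        refine lintegral_congr fun z => ?_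
        by_cases hz : z ∈ Φ.good
        · simp only [hfdef, indicator_of_mem hz]
        · simp only [hfdef, indicator_of_notMem hz, Finset.sum_const_zero]
    _ ≤ _ := hgen
    _ ≤ _ := liminf_le_of_frequently_le' hfreq

/-! ## In the window vocabulary: repeated collisions in one window are `O(σ² a² (N+1))` in the mean -/

/-- `ofReal (m − 1) ≤ (n − 1 : ℕ)` for naturals `m ≤ n` (real subtraction on the left, truncated on the right).
[folklore] -/
private theorem ofReal_natCast_sub_one_le {m n : ℕ} (h : m ≤ n) :
    ENNReal.ofReal ((m : ℝ) - 1) ≤ ((n - 1 : ℕ) : ℝ≥0∞) := by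
  rcases Nat.eq_zero_or_pos m with rfl | hm
  · rw [Nat.cast_zero, zero_sub, ENNReal.ofReal_of_nonpos (by norm_num)]
    exact bot_le
  · have h1 : ((m : ℝ) - 1) = ((m - 1 : ℕ) : ℝ) := by
      rw [Nat.cast_sub hm, Nat.cast_one]
    rw [h1, ENNReal.ofReal_natCast]
    exact_mod_cast Nat.sub_le_sub_right h 1

/-- **Repeated collisions of tagged spheres in one window, rung 0.**  In the vocabulary of
`CollisionWindowCompensator` (`D_{i,0} = windowCollisions σ N Φ τ a i 0`, the number of collision times of sphere `i`
in the first window `[0, w)`, `w = windowLen N τ a ≤ a (N+1)^{-1/3}`), under the hypotheses of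
`sum_lintegral_ncard_collisionTimesOf_sub_one_le` (`0 < σ ≤ 1/4`, constant profiles, `hstat`, `hpair`, `htriple`,
`htube`, `hlift`) and `τ, a > 0`:
`Σ_i ∫ (D_{i,0} − 1)₊ dG_N ≤ 192 σ² a² (N+1) · ∫ ‖q.2 − q.1‖² d(N(u,θ) ⊗ N(u,θ))`, uniformly in `N`
(`(N+1) ε² w ≤ σ² a`, `w ≤ a`, `σ² ≤ 1/16`): the mean number of spheres colliding twice or more in one window is
second order in the window fraction `a`, against `O(σ² a (N+1))` spheres colliding at all
(`TaggedSphereWindowCount`, CIP 1994 App. 4.A). [folklore] -/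
theorem sum_lintegral_windowCollisions_sub_one_le {σ : ℝ} (hσ : 0 < σ) (hσ4 : σ ≤ 1 / 4) {ab θb : ℝ}
    (hab : 0 < ab) (hθb : 0 < θb) (ub : V3) {N : ℕ}
    (Φ : HardSphereFlow (Torus.geometry (Fin 3)) (hsDiameter σ N) (N + 1))
    (hstat : ∀ t : ℝ, MeasurePreserving (Φ.flow t)
      (localGibbsLaw σ (fun _ => ab) (fun _ => ub) (fun _ => θb) N Φ)
      (localGibbsLaw σ (fun _ => ab) (fun _ => ub) (fun _ => θb) N Φ))
    (hpair : ∀ i j : Fin (N + 1), i ≠ j → ∀ S : Set T3, MeasurableSet S →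
      posGibbsMeasure (fun _ : T3 => (1 : ℝ)) (hsDiameter σ N) (N + 1) {x | x i - x j ∈ S} ≤ 4 * volume S)
    (htriple : ∀ i j k : Fin (N + 1), i ≠ j → i ≠ k → j ≠ k → ∀ S S' : Set T3, MeasurableSet S →
      MeasurableSet S' → posGibbsMeasure (fun _ : T3 => (1 : ℝ)) (hsDiameter σ N) (N + 1)
        {x | x j - x i ∈ S ∧ x k - x i ∈ S'} ≤ 8 * (volume S * volume S'))
    (htube : ∀ h : ℝ, 0 ≤ h → ∃ S : V3 → Set V3, MeasurableSet {q : V3 × V3 | q.1 ∈ S q.2} ∧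
      (∀ u, volume (S u) ≤ ENNReal.ofReal (4 * hsDiameter σ N ^ 2 * h * ‖u‖)) ∧
      ∀ (u r : V3) (s : ℝ), hsDiameter σ N ≤ ‖r‖ → s ∈ Icc 0 h → ‖r + s • u‖ = hsDiameter σ N → r ∈ S u)
    (hlift : ∀ B : Set V3, MeasurableSet B →
      volume {x : T3 | ∃ k : Fin 3 → ℤ, Torus.reprSym x + Torus.latticeVec k ∈ B} ≤ volume B)
    {τ a : ℝ} (hτ : 0 < τ) (ha : 0 < a) :
    ∑ i : Fin (N + 1), ∫⁻ z, ENNReal.ofReal (windowCollisions σ N Φ τ a i 0 z - 1)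
        ∂(localGibbsLaw σ (fun _ => ab) (fun _ => ub) (fun _ => θb) N Φ) ≤
      ENNReal.ofReal (192 * σ ^ 2 * a ^ 2 * ((N + 1 : ℕ) : ℝ)) *
        ∫⁻ q, ENNReal.ofReal (‖q.2 - q.1‖ ^ 2) ∂((gaussMeasure ub θb).prod (gaussMeasure ub θb)) := by
  set w : ℝ := windowLen N τ a with hwdef
  have hw : 0 < w := windowLen_pos N hτ ha
  -- the window factor: `(N+1) ε² w ≤ σ² a` and `w ≤ a`
  have hrpow : ((N + 1 : ℕ) : ℝ) ^ (-(1 / 3 : ℝ)) ≤ 1 :=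
    Real.rpow_le_one_of_one_le_of_nonpos (by exact_mod_cast Nat.succ_le_succ (Nat.zero_le N)) (by norm_num)
  have hwle : w ≤ a * ((N + 1 : ℕ) : ℝ) ^ (-(1 / 3 : ℝ)) := windowLen_le N hτ ha
  have hwa : w ≤ a := hwle.trans (by nlinarith)
  have hK : ((N + 1 : ℕ) : ℝ) * hsDiameter σ N ^ 2 * w ≤ σ ^ 2 * a := by
    have hkey := succ_mul_hsDiameter_sq_mul_nominalWindow hσ N a
    calc ((N + 1 : ℕ) : ℝ) * hsDiameter σ N ^ 2 * w
        ≤ ((N + 1 : ℕ) : ℝ) * hsDiameter σ N ^ 2 * (a * ((N + 1 : ℕ) : ℝ) ^ (-(1 / 3 : ℝ))) :=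
          mul_le_mul_of_nonneg_left hwle (by positivity)
      _ = σ ^ 2 * a := hkey
  -- pointwise: the window `[0, w)` lies in `[0, w]`
  have hpt : ∀ (i : Fin (N + 1)) (z : Config (N + 1) (Fin 3) T3),
      ENNReal.ofReal (windowCollisions σ N Φ τ a i 0 z - 1) ≤
        Φ.good.indicator (fun z => ((((collisionTimesOf (Torus.geometry (Fin 3)) (hsDiameter σ N)
          (fun t => Φ.flow t z) i ∩ Icc 0 w).ncard - 1 : ℕ) : ℝ≥0∞))) z := by
    intro i z
    unfold windowCollisions window
    by_cases hz : z ∈ Φ.good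
    · rw [if_pos hz, indicator_of_mem hz]
      have hfin : (collisionTimesOf (Torus.geometry (Fin 3)) (hsDiameter σ N) (fun t => Φ.flow t z) i ∩
          Icc 0 w).Finite :=
        ((Φ.isTrajectory z hz).locFinite 0 w).subset (inter_subset_inter_left _ (collisionTimesOf_subset _ i))
      simp only [Nat.cast_zero, zero_mul, zero_add, one_mul]
      exact ofReal_natCast_sub_one_le (Set.ncard_le_ncard (inter_subset_inter_right _ Ico_subset_Icc_self) hfin)
    · rw [if_neg hz, indicator_of_notMem hz]
      simp
  -- the real bookkeeping
  have hreal : 128 * w ^ 2 * ((N + 1 : ℕ) : ℝ) ^ 2 * hsDiameter σ N ^ 2 +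
      1024 * w ^ 2 * ((N + 1 : ℕ) : ℝ) ^ 3 * hsDiameter σ N ^ 4 ≤ 192 * σ ^ 2 * a ^ 2 * ((N + 1 : ℕ) : ℝ) := by
    have hε := hsDiameter_pos hσ N
    have hK0 : 0 ≤ ((N + 1 : ℕ) : ℝ) * hsDiameter σ N ^ 2 * w := by positivity
    have h1 : 128 * w ^ 2 * ((N + 1 : ℕ) : ℝ) ^ 2 * hsDiameter σ N ^ 2 =
        128 * ((N + 1 : ℕ) : ℝ) * ((((N + 1 : ℕ) : ℝ) * hsDiameter σ N ^ 2 * w) * w) := by ring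
    have h2 : 1024 * w ^ 2 * ((N + 1 : ℕ) : ℝ) ^ 3 * hsDiameter σ N ^ 4 =
        1024 * ((N + 1 : ℕ) : ℝ) * (((N + 1 : ℕ) : ℝ) * hsDiameter σ N ^ 2 * w) ^ 2 := by ring
    have h3 : (((N + 1 : ℕ) : ℝ) * hsDiameter σ N ^ 2 * w) * w ≤ σ ^ 2 * a * a :=
      mul_le_mul hK hwa hw.le (by positivity)
    have h4 : (((N + 1 : ℕ) : ℝ) * hsDiameter σ N ^ 2 * w) ^ 2 ≤ (σ ^ 2 * a) ^ 2 :=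
      pow_le_pow_left₀ hK0 hK 2
    have h5 : σ ^ 2 ≤ 1 / 16 := by nlinarith
    have hN0 : (0 : ℝ) ≤ ((N + 1 : ℕ) : ℝ) := Nat.cast_nonneg _
    rw [h1, h2]
    nlinarith [mul_le_mul_of_nonneg_left h3 (by positivity : (0 : ℝ) ≤ 128 * ((N + 1 : ℕ) : ℝ)),
      mul_le_mul_of_nonneg_left h4 (by positivity : (0 : ℝ) ≤ 1024 * ((N + 1 : ℕ) : ℝ)),
      mul_le_mul_of_nonneg_left h5 (by positivity : (0 : ℝ) ≤ 1024 * ((N + 1 : ℕ) : ℝ) * a ^ 2 * σ ^ 2)]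
  calc ∑ i : Fin (N + 1), ∫⁻ z, ENNReal.ofReal (windowCollisions σ N Φ τ a i 0 z - 1)
        ∂(localGibbsLaw σ (fun _ => ab) (fun _ => ub) (fun _ => θb) N Φ)
      ≤ ∑ i : Fin (N + 1), ∫⁻ z, Φ.good.indicator (fun z =>
          ((((collisionTimesOf (Torus.geometry (Fin 3)) (hsDiameter σ N) (fun t => Φ.flow t z) i ∩
            Icc 0 w).ncard - 1 : ℕ) : ℝ≥0∞))) z
          ∂(localGibbsLaw σ (fun _ => ab) (fun _ => ub) (fun _ => θb) N Φ) :=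
        Finset.sum_le_sum fun i _ => lintegral_mono (hpt i)
    _ ≤ _ := sum_lintegral_ncard_collisionTimesOf_sub_one_le hσ hσ4 hab hθb ub Φ hstat hpair htriple htube hlift hw
    _ ≤ _ := mul_le_mul_of_nonneg_right (ENNReal.ofReal_le_ofReal hreal) bot_le

end Literature.MathematicalPhysics.KineticTheory

end
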